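import Summits.BirchSwinnertonDyer.BirchSwinnertonDyer.Theorems.PrintX10bHowardAssembly
import Literature.NumberTheory.EllipticCurves.NonvanishingTwistsProofs
import Literature.NumberTheory.EllipticCurves.BSDHeegnerPoints
import Literature.NumberTheory.EllipticCurves.LeadingTermProofs
import Literature.NumberTheory.EllipticCurves.ComplexMultiplication
import Literature.NumberTheory.EllipticCurves.QuadraticTwist
import Literature.NumberTheory.EllipticCurves.MordellWeil
import HarnessLib

/-!
# Line «depth-minimal-heegner-supply» (bsd-idea-5 g8, line 2, lens TRANSFER) on crux
# `PrintX10b.HowardContainmentAnyClassNumberX10b` (stmt-BirchSwinnertonDyer-23729; row 10, rung W-ALL/10)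

BSD is not proved by any of this. PUBLISH-ONLY skeleton (W-79): nothing booked, no route edited.

TRANSFER (second step, after line «coprime-frame-supply»). Line 1 moved the row-10 residual to the
frame supply C⁺ = `SupplyCoprimeFrameX10b` (a light Heegner frame with `3 ∤ h_K` AND `L(E^{(d_K)},1) ≠ 0`),
whose load-bearing half is a weak-Goldfeld density statement in characteristic 0. This line replaces
the L-half by a 3-ADIC POSITION statement about Heegner points: ask for a light coprime frame `K` whose
Heegner point `P_K ∈ E(K)` has MINIMAL 3-DEPTH among the Heegner points of ALL Heegner frames of `E`
(depth = the largest `k` with `P ∈ 3^k·E(K) + E(K)_tors`). Some Heegner frame carries a point of finite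
depth (print: Gross–Zagier + Kolyvagin at a Hoffstein–Luo frame, Mordell–Weil), so a depth-minimal point
is non-torsion ⟹ (Gross–Zagier I.6.3, tree fact `analyticRankEK_eq_one_iff_heegner_nonTorsion`)
`ord_{s=1} L(E/K,s) = 1` ⟹ (`analyticRankEK_eq_add`, `r_an(E) = 1`) `r_an(E^{(d_K)}) = 0` ⟹
`L(E^{(d_K)},1) ≠ 0`, i.e. C⁺⁺ ⟹ C⁺ ⟹ rung. Depth is measured RELATIVE to the other frames, so the
statement is immune to the common Tamagawa/Manin/Ш(E) divisibility of all Heegner points of a carrier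
curve (Gross–Zagier V.2.2; Jetchev 2008): only the d-dependence counts.

WHY THE TRANSFERRED STATEMENT IS EASIER (the lever; details in `Lines/depth-minimal-heegner-supply-x10b.md`):
by Gross–Kohnen–Zagier (1987, Thm. C) `P_{K_d} ≐ c_E(d)·y` in `E(ℚ) ⊗ ℚ` with `c_E(d)` the Fourier
coefficients of the weight-3/2 (Jacobi) newform `g_E` attached to `f_E`; so minimal depth at `d` is
`c_E(d)/3^{v₀} ≢ 0 (mod 3)` (`v₀` = the minimal 3-valuation): a NON-VANISHING MOD 3 of half-integral
weight coefficients on the light class — the Sturm/Hecke world of Kohnen–Ono 1999, Ono–Skinner 1998,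
Bruinier 1999 (one certified `d₀` per residue class propagates to infinitely many), and, through
Kohnen–Zagier–Waldspurger + Vatsal's canonical-period congruence to the CM/dihedral twin of `f_E` mod 3
(the X10b image of `ρ̄_{E,3}` is a 2-group, so `ρ̄_{E,3}` is induced) + Katz, a 3-INDIVISIBILITY OF A
CLASS-NUMBER PIECE of `F_d = ℚ(E[3], √d)`; the class-number half `3 ∤ h(d)` is the `χ_d`-piece of the
same 3-class group. The joint supply becomes ONE statement about two isotypic pieces of `Cl(F_d)[3]`.

SKELETON (three stubs — ONE beyond print — + kernel-checked compositions; rev 2 2026-08-28T19:5xZ):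
* `stub_depthMinimalFrameSupply` — BEYOND PRINT, LOAD-BEARING (C⁺⁺).
* `stub_heegnerNonTorsionPrintFacts` (rev 2; replaces the opaque `stub_finiteDepthHeegnerPoint`) —
  PRINT BY NAME ×7: parity, Waldspurger/BFH, Murty–Murty, BCDT, Gross–Zagier I.6.3 iff, Gross 1984
  rationality `exists_isHeegnerPoint`, Mordell–Weil BY NAME `WeierstrassCurve.module_finite_point (W.baseChange K')` (tree named fact, MordellWeil.lean);
  E2 «a rank-one X10b curve has SOME Heegner frame whose Heegner point has finite 3-depth» is DERIVED
  sorry-free (`finiteDepthHeegnerPoint_of_print`, via the tree theorem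
  `exists_heegnerField_analyticRankEK_eq_one_of` and the PROVED Mordell–Weil depth lemmas
  `exists_linearMap_int_ne_zero`, `finiteDepth_of_not_isOfFinAddOrder`).
* `stub_grossZagierTwistFacts` — PRINT PACKAGE (Gross–Zagier 1986 I.6.3 + I.§7, modularity): three
  tree NAMED FACTS bundled (`analyticRankEK_eq_one_iff_heegner_nonTorsion`, `analyticRankEK_eq_add`,
  `WeierstrassCurve.hasEntireLFunction_rat`).
* `supplyCoprimeFrameX10b_of_depthMinimal` — C⁺⁺ → print → C⁺ (sorry-free).
* `wallCornerX10b_of_depthMinimal` — the rung BY NAME (via `X10.howardAssemblyThree_of_howardFrameSupply`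
  and `WAll.wallCornerX10b_of_bsdpOnClassX10b`, binders as in line 1).
-/

set_option autoImplicit false
set_option linter.dupNamespace false

noncomputable section

open scoped Classical

open WeierstrassCurve NumberField
  Literature.NumberTheory.EllipticCurves
  Summit.BirchSwinnertonDyer.BirchSwinnertonDyer.Theses.PrintX10b

open Literature.NumberTheory.EllipticCurves.Rank1Residual (Surj ClassX10)

namespace Summit.BirchSwinnertonDyer.BirchSwinnertonDyer.Cruxes.HowardContainmentAnyClassNumberX10b.DepthMinimalHeegnerSupplyX10b

/-! ## C⁺ (token-identical to line «coprime-frame-supply») -/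

/-- **C⁺ — coprime light Heegner frame supply on X10b** (= `CoprimeFrameSupplyX10b.SupplyCoprimeFrameX10b`
of line 1, = binder `hFS3` of `X10.howardAssemblyThree_of_howardFrameSupply`, verbatim). -/
def SupplyCoprimeFrameX10b : Prop :=
  ∀ (W : WeierstrassCurve ℚ) [W.IsElliptic] [W.IsGloballyMinimal] [NeZero (W.conductorNorm ℤ)]
    (p : ℕ) [Fact p.Prime],
    ClassX10 W p → ¬ Surj W 3 → ¬ W.HasCM → W.analyticRank = 1 →
    ∃ (K : Type) (_ : Field K) (_ : NumberField K),
      IsImaginaryQuadratic K ∧ Odd (NumberField.discr K) ∧ NumberField.discr K < -4 ∧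
      SatisfiesHeegnerHypothesis (W.conductorNorm ℤ) K ∧ SatisfiesHeegnerHypothesis p K ∧
      ¬ p ∣ NumberField.classNumber K ∧
      (W.quadraticTwist (NumberField.discr K : ℚ)).entireLFunction 1 ≠ 0

/-! ## C⁺⁺ — the depth-minimal Heegner frame supply -/

/-- `P ∈ 3^k·E(K) + E(K)_tors` ("3-depth of `P` is at least `k`"). -/
def DepthLE {K : Type} [Field K] [NumberField K] (W : WeierstrassCurve ℚ) (k : ℕ)
    (P : (W.baseChange K).toAffine.Point) : Prop :=
  ∃ Q : (W.baseChange K).toAffine.Point, IsOfFinAddOrder (P - (3 ^ k : ℕ) • Q)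

/-- The Heegner point `P ∈ E(K)` is **3-depth-minimal** among all Heegner points of `E`: every lower
bound for its 3-depth is a lower bound for the 3-depth of the Heegner point of any Heegner frame `K'`
(imaginary quadratic, Heegner for `N_E`; tree predicate `IsHeegnerPoint`). Under Gross–Kohnen–Zagier:
`ord₃ c_E(d_K) = min_{d'} ord₃ c_E(d')`. -/
def IsDepthMinimalHeegner {K : Type} [Field K] [NumberField K] (W : WeierstrassCurve ℚ)
    [NeZero (W.conductorNorm ℤ)] (P : (W.baseChange K).toAffine.Point) : Prop :=
  ∀ k : ℕ, DepthLE W k P →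
    ∀ (K' : Type) [Field K'] [NumberField K'], IsImaginaryQuadratic K' →
      SatisfiesHeegnerHypothesis (W.conductorNorm ℤ) K' →
      ∀ P' : (W.baseChange K').toAffine.Point, IsHeegnerPoint (W.conductorNorm ℤ) W K' P' → DepthLE W k P'

/-- **C⁺⁺ (beyond print, load-bearing).** Every non-CM X10b pair `(E,3)` with `ρ̄_{E,3}` not onto and
analytic rank one admits a light coprime Heegner frame `K` (odd `d_K < -4`, Heegner for `N_E` and `3`,
`3 ∤ h_K`) carrying a Heegner point that is 3-depth-minimal among all Heegner points of `E`.
Informally (GKZ): the minimal 3-valuation of the weight-3/2 coefficients `c_E(d)` over Heegner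
discriminants is attained on the light class at some `d` with `3 ∤ h(d)`. -/
def Stmt.depthMinimalHeegnerFrameSupplyX10b : Prop :=
  ∀ (W : WeierstrassCurve ℚ) [W.IsElliptic] [W.IsGloballyMinimal] [NeZero (W.conductorNorm ℤ)]
    (p : ℕ) [Fact p.Prime],
    ClassX10 W p → ¬ Surj W 3 → ¬ W.HasCM → W.analyticRank = 1 →
    ∃ (K : Type) (_ : Field K) (_ : NumberField K),
      IsImaginaryQuadratic K ∧ Odd (NumberField.discr K) ∧ NumberField.discr K < -4 ∧
      SatisfiesHeegnerHypothesis (W.conductorNorm ℤ) K ∧ SatisfiesHeegnerHypothesis p K ∧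
      ¬ p ∣ NumberField.classNumber K ∧
      ∃ P : (W.baseChange K).toAffine.Point,
        IsHeegnerPoint (W.conductorNorm ℤ) W K P ∧ IsDepthMinimalHeegner W P

/-- **Print (Gross–Zagier 1986 + Kolyvagin 1990 at a Bump–Friedberg–Hoffstein / Hoffstein–Luo frame;
Mordell–Weil).** A non-CM X10b curve of analytic rank one has SOME Heegner frame whose Heegner point
has finite 3-depth (a non-torsion point of the finitely generated group `E(K')`). -/
def Stmt.finiteDepthHeegnerPointX10b : Prop :=
  ∀ (W : WeierstrassCurve ℚ) [W.IsElliptic] [W.IsGloballyMinimal] [NeZero (W.conductorNorm ℤ)]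
    (p : ℕ) [Fact p.Prime],
    ClassX10 W p → ¬ Surj W 3 → ¬ W.HasCM → W.analyticRank = 1 →
    ∃ (K' : Type) (_ : Field K') (_ : NumberField K'),
      IsImaginaryQuadratic K' ∧ SatisfiesHeegnerHypothesis (W.conductorNorm ℤ) K' ∧
      ∃ (P' : (W.baseChange K').toAffine.Point) (k : ℕ),
        IsHeegnerPoint (W.conductorNorm ℤ) W K' P' ∧ ¬ DepthLE W k P'

/-- **Print package (Gross–Zagier 1986 Thm. I.6.3 and I.§7; modularity BCDT 2001).** The three tree
named facts used to pass from a non-torsion Heegner point to `L(E^{(d_K)},1) ≠ 0` when `r_an(E) = 1`. -/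
def Stmt.grossZagierTwistFacts : Prop :=
  (∀ (W : WeierstrassCurve ℚ) (N : ℕ) [NeZero N] (K : Type) [Field K] [NumberField K],
      analyticRankEK_eq_one_iff_heegner_nonTorsion W N K) ∧
  (∀ (W : WeierstrassCurve ℚ) (K : Type) [Field K] [NumberField K], analyticRankEK_eq_add W K) ∧
  WeierstrassCurve.hasEntireLFunction_rat

/-! ## E2 discharged to NAMED print facts (rev 2, critic V#112 P2) -/

/-- **PRINT PACKAGE for «some Heegner point of E has finite 3-depth»** — every conjunct a NAMED tree
fact or Mordell–Weil: (i) parity `W.even_analyticRank_iff` (bsd.G04); (ii) Waldspurger/BFH supply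
`waldspurger_exists_heegnerField_twist_ne_zero`; (iii) Murty–Murty `murtyMurty_exists_heegnerField_twist_simpleZero`;
(iv) entirety `hasEntireLFunction_rat` (BCDT); (v) Gross–Zagier I.6.3 iff
`analyticRankEK_eq_one_iff_heegner_nonTorsion` (bsd.S16); (vi) Heegner points are `K`-rational
`exists_isHeegnerPoint` (Gross 1984 §§3–4); (vii) Mordell–Weil over number fields for the base change
(`WeierstrassCurve.module_finite_point`, Silverman AEC VIII.6.7). [cite: GrossZagier1986, Thm. I.6.3]
[cite: SilvermanAEC2009, Thm. VIII.6.7] -/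
def Stmt.heegnerNonTorsionPrintFacts : Prop :=
  (∀ W : WeierstrassCurve ℚ, W.even_analyticRank_iff) ∧
  waldspurger_exists_heegnerField_twist_ne_zero ∧
  murtyMurty_exists_heegnerField_twist_simpleZero ∧
  WeierstrassCurve.hasEntireLFunction_rat ∧
  (∀ (W : WeierstrassCurve ℚ) (N : ℕ) [NeZero N] (K : Type) [Field K] [NumberField K],
      analyticRankEK_eq_one_iff_heegner_nonTorsion W N K) ∧
  (∀ (W : WeierstrassCurve ℚ) (K : Type) [Field K] [NumberField K], exists_isHeegnerPoint W K) ∧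
  (∀ (W : WeierstrassCurve ℚ) (K : Type) [Field K] [NumberField K],
      WeierstrassCurve.module_finite_point (W.baseChange K))

/-! ## Registered stubs -/

/-- stub E1 — C⁺⁺, BEYOND PRINT, load-bearing. -/
theorem stub_depthMinimalFrameSupply : Stmt.depthMinimalHeegnerFrameSupplyX10b := by
  sorry

/-- stub E2' — PRINT BY NAME ×7 (parity, Waldspurger/BFH, Murty–Murty, BCDT, GZ I.6.3, Gross 1984,
Mordell–Weil). [cite: GrossZagier1986, Thm. I.6.3] -/
theorem stub_heegnerNonTorsionPrintFacts : Stmt.heegnerNonTorsionPrintFacts := by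
  sorry

/-- stub E3 — PRINT package (GZ I.6.3 iff, `analyticRankEK_eq_add`, entirety). [cite: GrossZagier1986, Thm. I.6.3] -/
theorem stub_grossZagierTwistFacts : Stmt.grossZagierTwistFacts := by
  sorry

/-! ## Finite depth from Mordell–Weil (sorry-free) -/

/-- In a finitely generated abelian group a non-torsion element is detected by a homomorphism to `ℤ`
(`A/tors` is free: `Module.free_of_finite_type_torsion_free'`; duals separate points of free modules). -/
theorem exists_linearMap_int_ne_zero {A : Type*} [AddCommGroup A] [Module.Finite ℤ A]
    {P : A} (hP : ¬ IsOfFinAddOrder P) : ∃ f : A →ₗ[ℤ] ℤ, f P ≠ 0 := by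
  have hPT : (Submodule.torsion ℤ A).mkQ P ≠ 0 := by
    intro h
    rw [Submodule.mkQ_apply, Submodule.Quotient.mk_eq_zero, Submodule.mem_torsion_iff] at h
    obtain ⟨⟨n, hn⟩, hnP⟩ := h
    apply hP
    rw [isOfFinAddOrder_iff_zsmul_eq_zero]
    exact ⟨n, nonZeroDivisors.ne_zero hn, by simpa [Submonoid.mk_smul] using hnP⟩
  -- the two instances are supplied by term (the `Module ℤ` structure on the quotient is found by
  -- unification, not by instance synthesis)
  haveI hfin : Module.Finite ℤ (A ⧸ Submodule.torsion ℤ A) := Module.Finite.quotient ℤ _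
  haveI htf : Module.IsTorsionFree ℤ (A ⧸ Submodule.torsion ℤ A) :=
    Submodule.QuotientTorsion.instIsTorsionFree
  haveI : Module.Free ℤ (A ⧸ Submodule.torsion ℤ A) := Module.free_of_finite_type_torsion_free'
  obtain ⟨φ, hφ⟩ : ∃ φ : Module.Dual ℤ (A ⧸ Submodule.torsion ℤ A),
      φ ((Submodule.torsion ℤ A).mkQ P) ≠ 0 := by
    by_contra h
    push Not at h
    exact hPT ((Module.forall_dual_apply_eq_zero_iff ℤ ((Submodule.torsion ℤ A).mkQ P)).mp h)
  exact ⟨φ.comp (Submodule.torsion ℤ A).mkQ, hφ⟩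

/-- Mordell–Weil ⟹ a non-torsion point has finite 3-depth (`3^k ∣ f P ≠ 0` forces `3^k ≤ |f P| < 3^{|f P|}`). -/
theorem finiteDepth_of_not_isOfFinAddOrder {K' : Type} [Field K'] [NumberField K']
    (W : WeierstrassCurve ℚ) [Module.Finite ℤ (W.baseChange K').toAffine.Point]
    {P : (W.baseChange K').toAffine.Point} (hP : ¬ IsOfFinAddOrder P) : ∃ k : ℕ, ¬ DepthLE W k P := by
  obtain ⟨f, hf⟩ := exists_linearMap_int_ne_zero hP
  set k : ℕ := (f P).natAbs with hk
  refine ⟨k, ?_⟩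
  rintro ⟨Q, hQ⟩
  obtain ⟨n, hn, hnx⟩ := isOfFinAddOrder_iff_nsmul_eq_zero.mp hQ
  -- `f` kills the torsion element `P - 3^k • Q`
  have hfx : f (P - (3 ^ k : ℕ) • Q) = 0 := by
    have h0 : (n : ℤ) * f (P - (3 ^ k : ℕ) • Q) = 0 := by
      rw [← smul_eq_mul, ← map_zsmul, natCast_zsmul, hnx, map_zero]
    rcases mul_eq_zero.mp h0 with h | h
    · exact absurd (by exact_mod_cast h : n = 0) hn.ne'
    · exact h
  have hdiv : f P = ((3 ^ k : ℕ) : ℤ) * f Q := by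
    rw [map_sub, sub_eq_zero, map_nsmul, nsmul_eq_mul] at hfx
    exact hfx
  have habs : k = 3 ^ k * (f Q).natAbs :=
    calc k = (f P).natAbs := hk
      _ = (((3 ^ k : ℕ) : ℤ) * f Q).natAbs := by rw [hdiv]
      _ = 3 ^ k * (f Q).natAbs := by rw [Int.natAbs_mul, Int.natAbs_natCast]
  have hlt : k < 3 ^ k := Nat.lt_pow_self (by norm_num)
  rcases Nat.eq_zero_or_pos (f Q).natAbs with hq | hq
  · rw [hq, mul_zero] at habs
    exact hf (Int.natAbs_eq_zero.mp (hk ▸ habs))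
  · have h1 : 3 ^ k ≤ 3 ^ k * (f Q).natAbs := Nat.le_mul_of_pos_right _ hq
    omega

/-- **E2 from the print package** (sorry-free): a Waldspurger/Murty–Murty frame `K'` with
`r_an(E/K') = 1` carries a `K'`-rational Heegner point, non-torsion by Gross–Zagier I.6.3, of finite
3-depth by Mordell–Weil. -/
theorem finiteDepthHeegnerPoint_of_print (h : Stmt.heegnerNonTorsionPrintFacts) :
    Stmt.finiteDepthHeegnerPointX10b := by
  obtain ⟨hpar, hWa, hMM, hE, hGZ, hHeeg, hMW⟩ := h
  intro W _ _ _ p _ _hX _hns _hcm hr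
  obtain ⟨K', _, _, hK', hH, h1⟩ :=
    exists_heegnerField_analyticRankEK_eq_one_of hpar hWa hMM hE W hr.le
  obtain ⟨P', hP'⟩ := hHeeg W K' hK' hH
  have hnt : ¬ IsOfFinAddOrder P' := (hGZ W (W.conductorNorm ℤ) K' hK' rfl hH hP').mp h1
  haveI : (W.baseChange K').IsElliptic := by rw [WeierstrassCurve.baseChange]; infer_instance
  haveI : Module.Finite ℤ (W.baseChange K').toAffine.Point := hMW W K'
  obtain ⟨k, hk⟩ := finiteDepth_of_not_isOfFinAddOrder W hnt
  exact ⟨K', inferInstance, inferInstance, hK', hH, P', k, hP', hk⟩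

/-- E2, now derived (sorry only via the by-name print package). -/
theorem finiteDepthHeegnerPoint_of_stubs : Stmt.finiteDepthHeegnerPointX10b :=
  finiteDepthHeegnerPoint_of_print stub_heegnerNonTorsionPrintFacts

/-! ## Compositions (sorry-free) -/

/-- A torsion point has every 3-depth (`Q = 0`). -/
theorem depthLE_of_isOfFinAddOrder {K : Type} [Field K] [NumberField K] (W : WeierstrassCurve ℚ)
    {P : (W.baseChange K).toAffine.Point} (hP : IsOfFinAddOrder P) (k : ℕ) : DepthLE W k P :=
  ⟨0, by simpa using hP⟩

/-- A depth-minimal Heegner point is non-torsion as soon as SOME Heegner point has finite depth. -/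
theorem not_isOfFinAddOrder_of_isDepthMinimal {K K' : Type} [Field K] [NumberField K] [Field K']
    [NumberField K'] (W : WeierstrassCurve ℚ) [NeZero (W.conductorNorm ℤ)]
    {P : (W.baseChange K).toAffine.Point} (hmin : IsDepthMinimalHeegner W P)
    (hK' : IsImaginaryQuadratic K') (hH' : SatisfiesHeegnerHypothesis (W.conductorNorm ℤ) K')
    {P' : (W.baseChange K').toAffine.Point} (hP' : IsHeegnerPoint (W.conductorNorm ℤ) W K' P')
    {k : ℕ} (hk : ¬ DepthLE W k P') : ¬ IsOfFinAddOrder P := fun hP ↦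
  hk (hmin k (depthLE_of_isOfFinAddOrder W hP k) K' hK' hH' P' hP')

/-- **C⁺⁺ ⟹ C⁺** through the print stubs: depth-minimal ⟹ non-torsion ⟹ `ord_{s=1} L(E/K,s) = 1`
⟹ `r_an(E^{(d_K)}) = 0` ⟹ `L(E^{(d_K)},1) ≠ 0`. -/
theorem supplyCoprimeFrameX10b_of_depthMinimal (hF : Stmt.grossZagierTwistFacts)
    (hfin : Stmt.finiteDepthHeegnerPointX10b)
    (hS : Stmt.depthMinimalHeegnerFrameSupplyX10b) : SupplyCoprimeFrameX10b := by
  obtain ⟨hGZ, hadd, hent⟩ := hF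
  intro W _ _ _ p _ hX hns hcm hr
  obtain ⟨K, _, _, hK, hodd, hlt, hHN, hHp, hcop, P, hHP, hmin⟩ := hS W p hX hns hcm hr
  obtain ⟨K', _, _, hK', hH', P', k, hHP', hk⟩ := hfin W p hX hns hcm hr
  refine ⟨K, _, _, hK, hodd, hlt, hHN, hHp, hcop, ?_⟩
  have hnt : ¬ IsOfFinAddOrder P := not_isOfFinAddOrder_of_isDepthMinimal W hmin hK' hH' hHP' hk
  have h1 : analyticRankEK W K = 1 := (hGZ W (W.conductorNorm ℤ) K hK rfl hHN hHP).mpr hnt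
  have h2 := hadd W K
  have htw : (W.quadraticTwist (NumberField.discr K : ℚ)).analyticRank = 0 := by omega
  have hd0 : (NumberField.discr K : ℚ) ≠ 0 := by exact_mod_cast (IsImaginaryQuadratic.discr_neg hK).ne
  haveI := W.isElliptic_quadraticTwist hd0
  exact (analyticRank_eq_zero_iff_L_one_ne_zero_of_hasEntireLFunction_rat hent _).mp htw

/-- The class leaf `X10.BSDpOnClassX10b` from C⁺ (binders exactly as in line 1 / the tree kernel). -/
theorem bsdpOnClassX10b_of_supply (hS : SupplyCoprimeFrameX10b)
    (hMZ : MastellaZermanHowardDivisibility)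
    (hYZ : YanZhu2026.thm57_thm59_bcs422_cgls513_generator_constantCoeff_of_heegnerDivisibility)
    (hA : AnalyticMuZeroX10b) (hHP : HeegnerPrintFactsX10b) (hP : PrintFactsX10b) :
    Summit.BirchSwinnertonDyer.Rank1Residual.X10.BSDpOnClassX10b :=
  Summit.BirchSwinnertonDyer.Rank1Residual.X10.howardAssemblyThree_of_howardFrameSupply
    hS hMZ hYZ hA hHP hP

/-- **The rung W-ALL/10 BY NAME from C⁺⁺** and the named binders. -/
theorem wallCornerX10b_of_depthMinimal (hF : Stmt.grossZagierTwistFacts)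
    (hfin : Stmt.finiteDepthHeegnerPointX10b) (hS : Stmt.depthMinimalHeegnerFrameSupplyX10b)
    (hMZ : MastellaZermanHowardDivisibility)
    (hYZ : YanZhu2026.thm57_thm59_bcs422_cgls513_generator_constantCoeff_of_heegnerDivisibility)
    (hA : AnalyticMuZeroX10b) (hHP : HeegnerPrintFactsX10b) (hP : PrintFactsX10b) :
    Summit.BirchSwinnertonDyer.WAllCornerX10b :=
  Summit.BirchSwinnertonDyer.Rank1Residual.WAll.wallCornerX10b_of_bsdpOnClassX10b
    (bsdpOnClassX10b_of_supply (supplyCoprimeFrameX10b_of_depthMinimal hF hfin hS) hMZ hYZ hA hHP hP)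

/-- **Rung from the three stubs** (axioms: `sorryAx` only through the stubs). -/
theorem wallCornerX10b_of_stubs (hMZ : MastellaZermanHowardDivisibility)
    (hYZ : YanZhu2026.thm57_thm59_bcs422_cgls513_generator_constantCoeff_of_heegnerDivisibility)
    (hA : AnalyticMuZeroX10b) (hHP : HeegnerPrintFactsX10b) (hP : PrintFactsX10b) :
    Summit.BirchSwinnertonDyer.WAllCornerX10b :=
  wallCornerX10b_of_depthMinimal stub_grossZagierTwistFacts finiteDepthHeegnerPoint_of_stubs
    stub_depthMinimalFrameSupply hMZ hYZ hA hHP hP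

end Summit.BirchSwinnertonDyer.BirchSwinnertonDyer.Cruxes.HowardContainmentAnyClassNumberX10b.DepthMinimalHeegnerSupplyX10b
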